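import Summits.RiemannHypothesis.RiemannHypothesis.Theses.SpectralTrace
import Summits.RiemannHypothesis.RiemannHypothesis.Theorems.SpectralTraceWindowCompactness

/-!
# Sketch — crux-ideate `stmt-RiemannHypothesis-14659` (`SpectralTrace.WindowStep`), ideator 2, round 1

First lemmas of the crux idea card `floor-feedback` (folder `idea-floor-feedback.md`):
quantile quantisation of an explicit window density `Φ_A` with a BAND-LIMITED FEEDBACK `h`,
`N = ⌊Φ_A + h⌋`, `h = k ⋆ fract(Φ_A + h)` (`𝓕 k ≡ 1` on the window band). The jump set of
`⌊Φ_A + h⌋` is then an EXACT signed unit-atomic window family (K2, `FloorFeedbackSignedTrace`);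
a bounded solution `h` exists for every analytic `Φ` by Schauder–Tychonoff (K1,
`FloorFeedbackFixedPoint`); positivity of the atoms is automatic where `Φ_A' > sup |h'|`
(Bernstein), i.e. above an explicit height; the crux is the fold-exclusion below it
(`QuietStep`). Only definitions and the compositions are proved here (no `sorry`).
-/

noncomputable section

open Complex Set MeasureTheory
open scoped FourierTransform

namespace Summit.RiemannHypothesis.RiemannHypothesis.Cruxes.WindowStep.Ideator2

open Literature.NumberTheory.LFunctions
open Summit.RiemannHypothesis.RiemannHypothesis.Theses.SpectralTrace
open Summit.RiemannHypothesis.RiemannHypothesis.Theorems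

/-- The rung shape of the route: some real family reproduces `W` on the Weil tests supported in
`[-A, A]` (`WindowTraceArch = WTrace (log 2)`, the `n`-th rung is `WTrace (log n)`). -/
def WTrace (A : ℝ) : Prop :=
  ∃ (ι : Type) (γ : ι → ℝ), ∀ g : ℝ → ℂ, IsWeilTest g → tsupport g ⊆ Icc (-A) A →
    HasSum (fun i => weilMellin g (1 / 2 + (γ i : ℂ) * I)) (weilFunctional g)

/-- SIGNED rung: real atoms carrying signs `±1` reproduce `W` on the window. This relaxation is
what the line solves unconditionally (K0 + K1 + K2); the crux is to remove the signs. -/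
def SignedWTrace (A : ℝ) : Prop :=
  ∃ (ι : Type) (γ : ι → ℝ) (ε : ι → ℤ), (∀ i, ε i = 1 ∨ ε i = -1) ∧
    ∀ g : ℝ → ℂ, IsWeilTest g → tsupport g ⊆ Icc (-A) A →
      HasSum (fun i => (ε i : ℂ) * weilMellin g (1 / 2 + (γ i : ℂ) * I)) (weilFunctional g)

/-- A window density at level `A`: a real density `ρ` on the critical line realising `W` on the
window, `∫ ĝ(1/2+iT) ρ(T) dT = W(g)`. Explicit candidate (K0):
`ρ_A(T) = (1/2π)(Re ψ(1/4+iT/2) - log π) + k_A(T) - (1/π) Σ_{1<m<e^A} Λ(m) m^{-1/2} cos(T log m)`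
with `k_A` the (Schwartz) line transform of `2cosh(t/2)` times a smooth even cutoff `≡ 1` on
`[-A, A]` (`weilArchTerm_eq`, `integral_weilMellin_vertical`, Parseval). -/
def IsWindowDensity (A : ℝ) (ρ : ℝ → ℝ) : Prop :=
  ∀ g : ℝ → ℂ, IsWeilTest g → tsupport g ⊆ Icc (-A) A →
    Integrable (fun T : ℝ => weilMellin g (1 / 2 + (T : ℂ) * I) * (ρ T : ℂ)) ∧
    ∫ T : ℝ, weilMellin g (1 / 2 + (T : ℂ) * I) * (ρ T : ℂ) = weilFunctional g

/-- The regularity/growth package of a level-`A` model counting function `Φ` with `Φ' = ρ`: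
analytic, `ρ(T) = (1/2π) log(1+|T|) + O(1)`, polynomial growth, unbounded above. -/
def IsModelCount (A : ℝ) (Φ ρ : ℝ → ℝ) : Prop :=
  IsWindowDensity A ρ ∧ AnalyticOnNhd ℝ Φ univ ∧ (∀ T, HasDerivAt Φ (ρ T) T) ∧
    (∃ C : ℝ, ∀ T, |ρ T - (1 / (2 * Real.pi)) * Real.log (1 + |T|)| ≤ C) ∧
    (∃ C N : ℝ, ∀ T, |Φ T| ≤ C * (1 + |T|) ^ N) ∧ (∀ C : ℝ, ∃ T, C < Φ T)

/-- K0 (explicit; provable now, size M): every window has an analytic model counting function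
(primitive of the explicit density above). -/
def ModelCountExists : Prop := ∀ A : ℝ, 0 < A → ∃ Φ ρ : ℝ → ℝ, IsModelCount A Φ ρ

/-- Admissible feedback kernels for the window `A`: a real kernel with all moments whose
Fourier transform (Mathlib normalisation) is compactly supported and `≡ 1` on the band
`|w| ≤ A/2π` that carries the line transforms `T ↦ ĝ(1/2+iT)` of tests supported in `[-A, A]`
(`fourier_lineSample`: `𝓕[ĝ(1/2+i·)](w) = 2π g(2πw)`). -/
def IsFeedbackKernel (A : ℝ) (k : ℝ → ℝ) : Prop :=
  (∀ n : ℕ, Integrable fun T : ℝ => |T| ^ n * |k T|) ∧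
  HasCompactSupport (𝓕 (fun T : ℝ => (k T : ℂ))) ∧
  ∀ w : ℝ, |w| ≤ A / (2 * Real.pi) → 𝓕 (fun T : ℝ => (k T : ℂ)) w = 1

/-- K-aux (routine, size S): admissible kernels exist (inverse transform of a smooth plateau). -/
def FeedbackKernelExists : Prop := ∀ A : ℝ, 0 < A → ∃ k : ℝ → ℝ, IsFeedbackKernel A k

/-- The floor–feedback (noise-shaping) equation `h = k ⋆ fract(Φ + h)` with `h` bounded. -/
def IsFloorFeedback (Φ h k : ℝ → ℝ) : Prop :=
  (∃ C : ℝ, ∀ T, |h T| ≤ C) ∧ ∀ T : ℝ, h T = ∫ s : ℝ, k (T - s) * Int.fract (Φ s + h s)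

/-- **K1 (Schauder–Tychonoff; RH-free; size L).** For every real-analytic `Φ` of polynomial
growth, unbounded above, and every admissible kernel, the floor–feedback equation has a bounded
real-analytic solution with `sup |h| ≤ ‖k‖₁`. Mechanism: `h ↦ k ⋆ fract(Φ + h)` maps the
compact convex set `k ⋆ {b : 0 ≤ b ≤ 1}` (band-limited, bounded by `‖k‖₁`: a normal family)
continuously into itself — continuity because the level sets `{Φ + h ∈ ℤ}` of a non-constant
analytic function are Lebesgue-null. -/
def FloorFeedbackFixedPoint : Prop :=
  ∀ (A : ℝ) (Φ k : ℝ → ℝ), IsFeedbackKernel A k → AnalyticOnNhd ℝ Φ univ →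
    (∃ C N : ℝ, ∀ T, |Φ T| ≤ C * (1 + |T|) ^ N) → (∀ C : ℝ, ∃ T, C < Φ T) →
    ∃ h : ℝ → ℝ, IsFloorFeedback Φ h k ∧ AnalyticOnNhd ℝ h univ ∧ ∀ T, |h T| ≤ ∫ s : ℝ, |k s|

/-- **K2 = FIRST LEMMA of the line (floor–feedback ⇒ EXACT signed rung; RH-free; size L).**
If `Φ' = ρ` is a level-`A` window density and `h = k ⋆ fract(Φ + h)` with `𝓕k ≡ 1` on the
band, then the jump set of `⌊Φ + h⌋`, each jump signed by its direction, reproduces `W` EXACTLY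
on the window: `⌊Φ + h⌋ = Φ + u`, `u = h - fract(Φ + h) = k ⋆ b - b` (`b` bounded), so for a
test `g` supported in `[-A, A]`, `Σ ε_i ĝ(γ_i) = ∫ ĝ ρ + ∫ ĝ du = W(g) - ∫ (ĝ)′ u dT = W(g)`,
because `∫ F u = ∫ (F ⋆ ǩ - F) b = 0` for every line transform `F` of a test supported in
`[-A, A]` (`𝓕ǩ = 1` on `supp 𝓕F`). Local finiteness: `Φ + h` is analytic and non-constant. -/
def FloorFeedbackSignedTrace : Prop :=
  ∀ (A : ℝ) (Φ ρ h k : ℝ → ℝ), 0 < A → IsModelCount A Φ ρ → IsFeedbackKernel A k →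
    IsFloorFeedback Φ h k → AnalyticOnNhd ℝ h univ → SignedWTrace A

/-- Composition (kernel-checked): K0 + K-aux + K1 + K2 ⇒ SIGNED rungs for EVERY window,
unconditionally — the relaxation "unit masses, real positions, signs free" of the whole ladder. -/
theorem signedWTrace_of (h0 : ModelCountExists) (hk : FeedbackKernelExists)
    (h1 : FloorFeedbackFixedPoint) (h2 : FloorFeedbackSignedTrace) :
    ∀ A : ℝ, 0 < A → SignedWTrace A := by
  intro A hA
  obtain ⟨Φ, ρ, hmc⟩ := h0 A hA
  obtain ⟨k, hkk⟩ := hk A hA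
  obtain ⟨h, hfb, hhan, -⟩ := h1 A Φ k hkk hmc.2.1 hmc.2.2.2.2.1 hmc.2.2.2.2.2
  exact h2 A Φ ρ h k hA hmc hkk hfb hhan

/-! ## The positive (monotone) case and the transfer to the crux -/

/-- A QUIET rung at level `A`: a floor–feedback solution whose model-plus-feedback `Φ + h` is
strictly increasing — then every jump of `⌊Φ + h⌋` is `+1` and the family is an honest rung
family. Above the height where `ρ > sup|h′|` (Bernstein: `sup|h′| ≤ ‖k′‖₁`, while
`ρ(T) ≥ (1/2π) log(T/2π) - (1/π)Σ_{m<e^A} Λ(m)m^{-1/2}`) monotonicity is AUTOMATIC, so the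
condition only bites on a bounded interval of heights (`|T| ≤ 2π·exp(4 e^{A/2} + O(A log A))`). -/
def QuietRung (A : ℝ) : Prop :=
  ∃ (Φ ρ h k : ℝ → ℝ), IsModelCount A Φ ρ ∧ IsFeedbackKernel A k ∧ IsFloorFeedback Φ h k ∧
    AnalyticOnNhd ℝ h univ ∧ StrictMono fun T => Φ T + h T

/-- K2⁺ (the positive case of K2, same proof with all crossings upward; size L with K2). -/
def QuietRungTrace : Prop := ∀ A : ℝ, 0 < A → QuietRung A → WTrace A

/-- The seed in quiet form (implies `WindowTraceArch` by K2⁺). -/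
def QuietArch : Prop := QuietRung (Real.log 2)

/-- **TRANSFER `C⁺` of the crux: the quiet step.** From a quiet rung at level `log n` obtain one
at level `log (n+1)`: follow the Leray–Schauder continuum of floor–feedback solutions from
window `log n` to `log (n+1)` WITHOUT A FOLD (a point where `(Φ + h)′` vanishes = birth of an
anti-atom) below the automatic-positivity height. -/
def QuietStep : Prop :=
  ∀ n : ℕ, 2 ≤ n → QuietRung (Real.log n) → QuietRung (Real.log (n + 1))

/-- Quiet seed + quiet step give every quiet rung (plain induction; casts by `Nat.cast_succ`). -/
theorem quietRung_of (hA : QuietArch) (hS : QuietStep) :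
    ∀ n : ℕ, 2 ≤ n → QuietRung (Real.log n) := by
  intro n hn
  induction n, hn using Nat.le_induction with
  | base =>
    have h2 : QuietRung (Real.log 2) := hA
    simpa using h2
  | succ m hm ih =>
    have h := hS m hm ih
    simpa [Nat.cast_succ] using h

/-- The quiet ladder proves RH (ladder of honest rungs, then `riemannHypothesis_of_ladder`). -/
theorem riemannHypothesis_of_quiet (hT : QuietRungTrace) (hA : QuietArch) (hS : QuietStep) :
    _root_.RiemannHypothesis := by
  have hr : ∀ n : ℕ, 2 ≤ n → WTrace (Real.log n) := fun n hn =>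
    hT _ (Real.log_pos (by exact_mod_cast (by omega : 1 < n))) (quietRung_of hA hS n hn)
  refine riemannHypothesis_of_ladder fun A _ => ?_
  obtain ⟨n, hn⟩ := exists_nat_ge (Real.exp A)
  obtain ⟨ι, γ, hγ⟩ := hr (n + 2) (by omega)
  have hpos : (0 : ℝ) < ((n + 2 : ℕ) : ℝ) := by positivity
  have hAn : A ≤ Real.log ((n + 2 : ℕ) : ℝ) := by
    rw [Real.le_log_iff_exp_le hpos]
    push_cast
    linarith
  exact ⟨ι, γ, fun g hg hgs => hγ g hg (hgs.trans (Icc_subset_Icc (neg_le_neg hAn) hAn))⟩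

/-- **`C⁺ → crux` (kernel-checked).** Quiet seed + quiet step + K2⁺ prove `WindowStep` BY NAME
(through RH and `spectralThesis_of_riemannHypothesis`, i.e. the `←` direction of the landed
collapse lemma `windowStep_iff_windowTraceArch_imp_riemannHypothesis`,
Theorems/WindowStep/Negative/Collapse.lean). -/
theorem windowStep_of_quiet (hT : QuietRungTrace) (hA : QuietArch) (hS : QuietStep) :
    WindowStep := by
  intro n _ _
  obtain ⟨ι, γ, hγ⟩ := spectralThesis_of_riemannHypothesis (riemannHypothesis_of_quiet hT hA hS)
  exact ⟨ι, γ, fun g hg _ => hγ g hg⟩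

end Summit.RiemannHypothesis.RiemannHypothesis.Cruxes.WindowStep.Ideator2
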